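import Summits.HodgeConjecture.HodgeConjecture.Theorems.F0P3cStCharTSTwistedTubeCore       -- ★ (C8b-core): sub-box kit, `twisted_newton`, `tube_eq_mul_chart_twisted`, `tube_measure_eq_twisted` (brings ★ C1–C5, C8a)
import HarnessLib

/-!
# F0 · P3c · line LH6 «StCharTS» — WIF antecedent, ELLIPTIC half: brick (C8b-product) «THE CHART PRODUCT MAP `Ξ = S(pM ·, pT ·)` ON THE SUB-BOX»

Cell `pub/hodgecm-mathlib`, crux H413 = `stmt-HodgeConjecture-24833` (lane `--supports … --as helper`); seat LH5-p02 (g6); ROAD «JAC-ELL» v1 §2 step (2)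
(the sub-box window (Q10) folded in), in ★ (C4)'s ABSTRACT frame (`ι : V →+ M_m(K)` a closed embedding, `ρ : G →* GL_m(K)` injective, levels
`Λ j = ι⁻¹{ValBound α^{j+1}}`, chart `c` = Cayley on `Λ 0`, chart product `σV`) augmented by complementary additive projections `pM + pT = id` of `V`.
THEOREMS ONLY; Mathlib + ★ (C1)–(C5), (C8a), (C8b-core).

* §0 `continuousAt_sandwich` — JOINT continuity of the Cayley product sandwich `S(W, X) = (1 − W)⁻¹(W + X)(1 + WX)⁻¹(1 − W)` where its two inverses exist;
  `continuousOn_product`, `continuousOn_twisted` — continuity of the product map `Ξ = S(pM ·, pT ·)` and of the tube map `Θ` of ★ (C8b-core) on the sub-box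
  (discharges ★ (C8b-core)'s hypothesis `hΘc`).
* §1 chart images: `isOpen_image_of_subset` (open subsets of the base box have open images), `chart_zero`, `chart_neg`, `exists_image_level_subset` (the
  `c(Λ_j)` shrink to `1`), `translation_newton_level` ∕ `mul_mem_image_level` ∕ `inv_mul_mem_image_level` (every `c(Λ_j)` is closed under `x⁻¹y`),
  `image_vadd_eq_smul_image` (`c(Y + Λ_j) = c(Y)·c(Λ_j)`).
* §2 the product map: `product_newton` (`Ξ` satisfies the filtered Newton hypothesis `(N)` on the sub-box `Λ′` at depth `k`), `chart_product`
  (`c(Ξ Z) = c(pM Z)·c(pT Z)`), `product_mem_level`, `product_zero`.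

Purpose: first third of the local tube-Jacobian socket (E1b) on the model; consumed by ★-cand `F0P3cStCharTSJacCartanWindow` ∕ `…SocketCore`.
HONEST LABEL: count-neutral helper algebra ∕ measure theory; closes no organ; HC_CM is proved only modulo the printed citations (h413 = `stmt-HodgeConjecture-24833`).

## References
* [HarishChandra1970] Harish-Chandra (notes by G. van Dijk), *Harmonic Analysis on Reductive p-adic Groups*, LNM 162 (1970), Lemma 22 (the tube map and
  its Jacobian). Context locator.
* [Serre1992LALG] J.-P. Serre, *Lie Algebras and Lie Groups*, LNM 1500 (1992), Part II Ch. IV §8 (Cayley∕exponential charts), §9 (filtrations). Context locator.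
* [DeitmarEchterhoff2014] A. Deitmar, S. Echterhoff, *Principles of Harmonic Analysis*, 2nd ed., Thm. 1.5.3 (quotient integral formula). Context locator.
-/

set_option autoImplicit false
set_option linter.dupNamespace false

open Set Filter MeasureTheory MeasureTheory.Measure TopologicalSpace Topology Matrix ValuativeRel
open Literature.NumberTheory.Automorphic Literature.NumberTheory.Weil1982.UnitaryFinTopForm Literature.MeasureTheory.Group
open Summit.HodgeConjecture.HodgeConjecture.Cruxes.H413.F0P3cStCharTSCayleyChartHaar
open Summit.HodgeConjecture.HodgeConjecture.Cruxes.H413.F0P3cStCharTSFilteredNewton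
open Summit.HodgeConjecture.HodgeConjecture.Cruxes.H413.F0P3cStCharTSFilteredNewtonHaar
open Summit.HodgeConjecture.HodgeConjecture.Cruxes.H413.F0P3cStCharTSNewtonChartHaar
open Summit.HodgeConjecture.HodgeConjecture.Cruxes.H413.F0P3cStCharTSTwistedTubeCore
open scoped Pointwise Topology ENNReal MatrixGroups

namespace Summit.HodgeConjecture.HodgeConjecture.Cruxes.H413.F0P3cStCharTSJacCartanProduct

/-! ## §0 Joint continuity of the Cayley product sandwich -/

section Sandwich

variable {K : Type*} [Field K] [ValuativeRel K] [TopologicalSpace K] [IsNonarchimedeanLocalField K] {m : Type*} [Fintype m] [DecidableEq m]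

/-- Matrix inversion is continuous at a matrix with unit determinant. [cite: Serre1992LALG, Part II Ch. IV §8] -/
theorem continuousAt_matrix_inv_of_isUnit {M : Matrix m m K} (hM : IsUnit M.det) : ContinuousAt Inv.inv M :=
  continuousAt_matrix_inv _ (by rw [Ring.inverse_eq_inv']; exact continuousAt_inv₀ hM.ne_zero)

/-- **The sandwich `S(W, X) = (1 − W)⁻¹ (W + X) (1 + W X)⁻¹ (1 − W)` is jointly continuous** at every `(W, X)` where `1 − W` and `1 + WX` are invertible.
[cite: Serre1992LALG, Part II Ch. IV §8] -/
theorem continuousAt_sandwich {W X : Matrix m m K} (h1 : IsUnit (1 - W).det) (h2 : IsUnit (1 + W * X).det) :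
    ContinuousAt (fun p : Matrix m m K × Matrix m m K => (1 - p.1)⁻¹ * (p.1 + p.2) * (1 + p.1 * p.2)⁻¹ * (1 - p.1)) (W, X) := by
  have hi1 : ContinuousAt (fun p : Matrix m m K × Matrix m m K => (1 - p.1)⁻¹) (W, X) :=
    ContinuousAt.comp (g := Inv.inv) (f := fun p : Matrix m m K × Matrix m m K => 1 - p.1) (continuousAt_matrix_inv_of_isUnit h1)
      (continuous_const.sub continuous_fst).continuousAt
  have hi2 : ContinuousAt (fun p : Matrix m m K × Matrix m m K => (1 + p.1 * p.2)⁻¹) (W, X) :=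
    ContinuousAt.comp (g := Inv.inv) (f := fun p : Matrix m m K × Matrix m m K => 1 + p.1 * p.2) (continuousAt_matrix_inv_of_isUnit h2)
      (continuous_const.add (continuous_fst.mul continuous_snd)).continuousAt
  exact ((hi1.mul (continuous_fst.add continuous_snd).continuousAt).mul hi2).mul (continuous_const.sub continuous_fst).continuousAt

/-- Continuity of `S` at a point of the box `ValBound a × ValBound b`, `a < 1`, `b ≤ 1`. [cite: Serre1992LALG, Part II Ch. IV §8] -/
theorem continuousAt_sandwich_of_valBound {a b : ValueGroupWithZero K} {W X : Matrix m m K} (hW : ValBound a W) (hX : ValBound b X) (ha : a < 1) (hb : b ≤ 1) :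
    ContinuousAt (fun p : Matrix m m K × Matrix m m K => (1 - p.1)⁻¹ * (p.1 + p.2) * (1 + p.1 * p.2)⁻¹ * (1 - p.1)) (W, X) :=
  continuousAt_sandwich (isUnit_det_one_sub_of_valBound hW ha).1 (isUnit_det_one_add_mul_of_valBound hW hX ha hb).1

end Sandwich

/-! ## §1 Chart images -/

section Chart

variable {K : Type*} [Field K] [ValuativeRel K] [TopologicalSpace K] [IsNonarchimedeanLocalField K]
  {m : Type*} [Fintype m] [DecidableEq m]
  {V : Type*} [AddCommGroup V] [TopologicalSpace V]
  {G : Type*} [Group G] [TopologicalSpace G]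
  (ι : V →+ Matrix m m K) (Λ : ℕ → AddSubgroup V) {α : ValueGroupWithZero K} (ρ : G →* GL m K) (c : V → G) (σV : V → V → V)

omit [Fintype m] [DecidableEq m] [ValuativeRel K] [TopologicalSpace K] [IsNonarchimedeanLocalField K] [AddCommGroup V] [Group G] in
/-- **Open subsets of the base box have open chart images**: `c` is continuous and injective on the compact `Λ 0` with open image, so `c(A) = c(Λ 0) ∖ c(Λ 0 ∖ A)` is open.
[cite: Serre1992LALG, Part II Ch. IV §8] -/
theorem isOpen_image_of_subset [T2Space G] {B : Set V} (hcont : ContinuousOn c B) (hinj : InjOn c B) (hcomp : IsCompact B) (hopenB : IsOpen (c '' B))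
    {A : Set V} (hA : IsOpen A) (hAB : A ⊆ B) : IsOpen (c '' A) := by
  have h1 : c '' A = c '' B \ c '' (B \ A) := by
    rw [← hinj.image_sdiff_subset Set.sdiff_subset, Set.sdiff_sdiff_cancel_left hAB]
  rw [h1]
  exact hopenB.sdiff ((hcomp.diff hA).image_of_continuousOn (hcont.mono Set.sdiff_subset)).isClosed

omit [ValuativeRel K] [TopologicalSpace K] [IsNonarchimedeanLocalField K] [TopologicalSpace V] [TopologicalSpace G] in
/-- `c 0 = 1`. [cite: PlatonovRapinchuk1994, §3.3] -/
theorem chart_zero (hρinj : Function.Injective ρ)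
    (hc : ∀ X ∈ Λ 0, ((ρ (c X) : GL m K) : Matrix m m K) = cayley (ι X)) : c 0 = 1 := by
  apply hρinj
  apply Units.ext
  rw [hc 0 (zero_mem _), map_zero, map_one, Units.val_one, cayley]
  simp

omit [TopologicalSpace K] [IsNonarchimedeanLocalField K] [TopologicalSpace V] [TopologicalSpace G] in
/-- `c (−W) = (c W)⁻¹` on every level. [cite: PlatonovRapinchuk1994, §3.3] -/
theorem chart_neg (hΛ : ∀ j X, X ∈ Λ j ↔ ValBound (α ^ (j + 1)) (ι X)) (hα1 : α < 1) (hρinj : Function.Injective ρ)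
    (hc : ∀ X ∈ Λ 0, ((ρ (c X) : GL m K) : Matrix m m K) = cayley (ι X)) {W : V} (hW : W ∈ Λ 0) : c (-W) = (c W)⁻¹ := by
  apply hρinj
  rw [map_inv, rho_chart_eq_cayleyGL ι Λ ρ c hΛ hα1 hc hW]
  apply Units.ext
  rw [hc _ (neg_mem hW), map_neg, coe_cayleyGL_inv]

omit [Fintype m] [DecidableEq m] [ValuativeRel K] [TopologicalSpace K] [IsNonarchimedeanLocalField K] in
/-- **The chart images `c(Λ_j)` shrink to the identity**: every neighbourhood of `1` in `G` contains some `c(Λ_j)`. [cite: Serre1992LALG, Part II Ch. IV §8] -/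
theorem exists_image_level_subset (hopen : ∀ j, IsOpen (Λ j : Set V)) (hbasis : ∀ U ∈ 𝓝 (0 : V), ∃ j, (Λ j : Set V) ⊆ U)
    (hcont : ContinuousOn c (Λ 0 : Set V)) (h0 : c 0 = 1) : ∀ O ∈ 𝓝 (1 : G), ∃ j, c '' (Λ j : Set V) ⊆ O := by
  intro O hO
  have h1 : c ⁻¹' O ∈ 𝓝[(Λ 0 : Set V)] (0 : V) := hcont 0 (zero_mem _) (by rwa [h0])
  have h2 : c ⁻¹' O ∩ (Λ 0 : Set V) ∈ 𝓝 (0 : V) := by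
    rw [← nhdsWithin_eq_nhds.2 ((hopen 0).mem_nhds (zero_mem _))]
    exact Filter.inter_mem h1 self_mem_nhdsWithin
  obtain ⟨j, hj⟩ := hbasis _ h2
  exact ⟨j, image_subset_iff.2 fun X hX => (hj hX).1⟩

variable [IsTopologicalAddGroup V] [T2Space V]

omit [IsNonarchimedeanLocalField K] [TopologicalSpace G] [IsTopologicalAddGroup V] [T2Space V] in
/-- The translation maps `σV W`, `W ∈ Λ j₀`, satisfy the filtered Newton hypothesis at every depth `j₀` (★ C4 `chart_translation_newton` restricted).
[cite: Serre1992LALG, Part II Ch. IV §8] -/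
theorem translation_newton_level (hι : IsClosedEmbedding ι) (hΛ : ∀ j X, X ∈ Λ j ↔ ValBound (α ^ (j + 1)) (ι X)) (hα1 : α < 1) (h2 : (2 : K) ≠ 0)
    (hρinj : Function.Injective ρ) (hc : ∀ X ∈ Λ 0, ((ρ (c X) : GL m K) : Matrix m m K) = cayley (ι X))
    (hσ : ∀ W ∈ Λ 0, ∀ X ∈ Λ 0, ι (σV W X) = (1 - ι W)⁻¹ * (ι W + ι X) * (1 + ι W * ι X)⁻¹ * (1 - ι W))
    (hσc : ∀ W ∈ Λ 0, ContinuousOn (σV W) (Λ 0 : Set V)) (j₀ : ℕ) :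
    ∀ W ∈ Λ j₀, ∃ ψ : V → V, ContinuousOn ψ (Λ j₀ : Set V) ∧ ψ 0 ∈ Λ j₀ ∧
      (∀ j, j₀ ≤ j → ∀ x ∈ Λ j₀, ∀ y ∈ Λ j, ψ (x + y) - ψ x - y ∈ Λ (j + 1)) ∧ ∀ X ∈ Λ j₀, c (ψ X) = c W * c X := by
  have hanti := level_antitone ι Λ hΛ hα1.le
  intro W hW
  have hW0 : W ∈ Λ 0 := hanti (Nat.zero_le _) hW
  obtain ⟨ψ, hψc, hψ0, hN, hmul⟩ := chart_translation_newton ι Λ ρ c σV hι.injective hΛ hα1 hρinj hc hσ hσc W hW0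
  have hψ0W : ψ 0 = W := by
    have h := hmul 0 (zero_mem _)
    rw [chart_zero ι Λ ρ c hρinj hc, mul_one] at h
    exact injOn_chart ι Λ ρ c h2 hι.injective hΛ hα1 hc hψ0 hW0 h
  refine ⟨ψ, hψc.mono (hanti (Nat.zero_le _)), by rw [hψ0W]; exact hW, fun j hj x hx y hy => hN j (Nat.zero_le _) x (hanti (Nat.zero_le _) hx) y hy,
    fun X hX => hmul X (hanti (Nat.zero_le _) hX)⟩

omit [TopologicalSpace G] in
/-- **Every chart image `c(Λ_j)` is closed under products** (★ C3 `mul_mem_image` at depth `j`). [cite: Serre1992LALG, Part II Ch. IV §8] -/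
theorem mul_mem_image_level (hι : IsClosedEmbedding ι) (hΛ : ∀ j X, X ∈ Λ j ↔ ValBound (α ^ (j + 1)) (ι X)) (hα : α ≠ 0) (hα1 : α < 1) (h2 : (2 : K) ≠ 0)
    (hρinj : Function.Injective ρ) (hc : ∀ X ∈ Λ 0, ((ρ (c X) : GL m K) : Matrix m m K) = cayley (ι X))
    (hσ : ∀ W ∈ Λ 0, ∀ X ∈ Λ 0, ι (σV W X) = (1 - ι W)⁻¹ * (ι W + ι X) * (1 + ι W * ι X)⁻¹ * (1 - ι W))
    (hσc : ∀ W ∈ Λ 0, ContinuousOn (σV W) (Λ 0 : Set V)) {j : ℕ} {W X : V} (hW : W ∈ Λ j) (hX : X ∈ Λ j) :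
    c W * c X ∈ c '' (Λ j : Set V) :=
  mul_mem_image Λ c (level_antitone ι Λ hΛ hα1.le) (isOpen_level ι Λ hι.continuous hΛ hα) (isCompact_level ι Λ hι hΛ j)
    (exists_level_subset_of_mem_nhds ι Λ hι hΛ hα1) (translation_newton_level ι Λ ρ c σV hι hΛ hα1 h2 hρinj hc hσ hσc j) hW hX

omit [TopologicalSpace K] [IsNonarchimedeanLocalField K] [TopologicalSpace V] [TopologicalSpace G] [IsTopologicalAddGroup V] [T2Space V] in
/-- **`c(Λ_j)` is closed under `x⁻¹ y`**. [cite: Serre1992LALG, Part II Ch. IV §8] -/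
theorem inv_mul_mem_image_level (hΛ : ∀ j X, X ∈ Λ j ↔ ValBound (α ^ (j + 1)) (ι X)) (hα1 : α < 1)
    (hρinj : Function.Injective ρ) (hc : ∀ X ∈ Λ 0, ((ρ (c X) : GL m K) : Matrix m m K) = cayley (ι X))
    {j : ℕ} (hmul : ∀ {W X : V}, W ∈ Λ j → X ∈ Λ j → c W * c X ∈ c '' (Λ j : Set V)) {W X : V} (hW : W ∈ Λ j) (hX : X ∈ Λ j) :
    (c W)⁻¹ * c X ∈ c '' (Λ j : Set V) := by
  rw [← chart_neg ι Λ ρ c hΛ hα1 hρinj hc (level_antitone ι Λ hΛ hα1.le (Nat.zero_le _) hW)]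
  exact hmul (neg_mem hW) hX

omit [TopologicalSpace G] in
/-- **`c(Y + Λ_j) = c(Y) · c(Λ_j)`** for `Y ∈ Λ j₀`, `j ≥ j₀` (★ C1 `image_vadd_eq_of_newton` for the translation map). [cite: Serre1992LALG, Part II Ch. IV §8] -/
theorem image_vadd_eq_smul_image (hι : IsClosedEmbedding ι) (hΛ : ∀ j X, X ∈ Λ j ↔ ValBound (α ^ (j + 1)) (ι X)) (hα : α ≠ 0) (hα1 : α < 1) (h2 : (2 : K) ≠ 0)
    (hρinj : Function.Injective ρ) (hc : ∀ X ∈ Λ 0, ((ρ (c X) : GL m K) : Matrix m m K) = cayley (ι X))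
    (hσ : ∀ W ∈ Λ 0, ∀ X ∈ Λ 0, ι (σV W X) = (1 - ι W)⁻¹ * (ι W + ι X) * (1 + ι W * ι X)⁻¹ * (1 - ι W))
    (hσc : ∀ W ∈ Λ 0, ContinuousOn (σV W) (Λ 0 : Set V)) {j₀ j : ℕ} (hj : j₀ ≤ j) {Y : V} (hY : Y ∈ Λ j₀) :
    c '' (Y +ᵥ (Λ j : Set V)) = c Y • c '' (Λ j : Set V) := by
  have hanti := level_antitone ι Λ hΛ hα1.le
  obtain ⟨ψ, hψc, hψ0, hN, hmul⟩ := translation_newton_level ι Λ ρ c σV hι hΛ hα1 h2 hρinj hc hσ hσc j₀ Y hY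
  have hψ0Y : ψ 0 = Y := by
    have h := hmul 0 (zero_mem _)
    rw [chart_zero ι Λ ρ c hρinj hc, mul_one] at h
    exact injOn_chart ι Λ ρ c h2 hι.injective hΛ hα1 hc (hanti (Nat.zero_le _) hψ0) (hanti (Nat.zero_le _) hY) h
  have himg := image_vadd_eq_of_newton Λ ψ hanti (isOpen_level ι Λ hι.continuous hΛ hα) (isCompact_level ι Λ hι hΛ j₀)
    (exists_level_subset_of_mem_nhds ι Λ hι hΛ hα1) hψc hN hj (zero_mem _)
  rw [zero_vadd, hψ0Y] at himg
  rw [← himg, image_image]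
  ext g
  simp only [mem_image, Set.mem_smul_set, smul_eq_mul]
  constructor
  · rintro ⟨X, hX, rfl⟩
    exact ⟨c X, ⟨X, hX, rfl⟩, (hmul X (hanti hj hX)).symm⟩
  · rintro ⟨_, ⟨X, hX, rfl⟩, rfl⟩
    exact ⟨X, hX, hmul X (hanti hj hX)⟩

end Chart

/-! ## §2 The product map `Ξ = S(pM ·, pT ·)` on the sub-box -/

section Product

variable {K : Type*} [Field K] [ValuativeRel K] [TopologicalSpace K] [IsNonarchimedeanLocalField K]
  {m : Type*} [Fintype m] [DecidableEq m]
  {V : Type*} [AddCommGroup V] [TopologicalSpace V]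
  {G : Type*} [Group G]
  (ι : V →+ Matrix m m K) (Λ : ℕ → AddSubgroup V) {α : ValueGroupWithZero K} (ρ : G →* GL m K) (c : V → G)
  (pM pT : V →+ V) {Λ' : ℕ → AddSubgroup V} (Ξ : V → V) {k : ℕ}

omit [TopologicalSpace K] [IsNonarchimedeanLocalField K] [TopologicalSpace V] [Group G] in
/-- **`(N)` FOR THE PRODUCT MAP**: `Ξ (Z + Z₁) − Ξ Z − Z₁ ∈ Λ′ (j + 1)` for `Z ∈ Λ′ k`, `Z₁ ∈ Λ′ j`, `j ≥ k` (★ C5 `valBound_cayleySandwich_incr_both` + the depth-`k` shift).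
[cite: Serre1992LALG, Part II Ch. IV §8] -/
theorem product_newton (hΛ : ∀ j X, X ∈ Λ j ↔ ValBound (α ^ (j + 1)) (ι X)) (hα1 : α < 1)
    (hΛ' : ∀ j Z, Z ∈ Λ' j ↔ (pM Z ∈ Λ j ∧ pT Z ∈ Λ j)) (hsum : ∀ Z, pM Z + pT Z = Z)
    (hshift : ∀ j, ∀ Z ∈ Λ (j + k), pM Z ∈ Λ j ∧ pT Z ∈ Λ j)
    (hΞ : ∀ Z ∈ Λ' k, ι (Ξ Z) = (1 - ι (pM Z))⁻¹ * (ι (pM Z) + ι (pT Z)) * (1 + ι (pM Z) * ι (pT Z))⁻¹ * (1 - ι (pM Z))) :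
    ∀ j, k ≤ j → ∀ x ∈ Λ' k, ∀ y ∈ Λ' j, Ξ (x + y) - Ξ x - y ∈ Λ' (j + 1) := by
  intro j hj x hx y hy
  have hanti' : Antitone Λ' := subBox_antitone hΛ' (level_antitone ι Λ hΛ hα1.le)
  have hαk1 : α ^ (k + 1) < 1 := pow_lt_one₀ zero_le hα1 (Nat.succ_ne_zero k)
  obtain ⟨hxM, hxT⟩ := (hΛ' k x).1 hx
  obtain ⟨hyM, hyT⟩ := (hΛ' j y).1 hy
  have hxy : x + y ∈ Λ' k := add_mem hx (hanti' hj hy)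
  have hle : α ^ (j + 1) ≤ α ^ (k + 1) := pow_le_pow_right_of_le_one' hα1.le (by omega)
  have key := valBound_cayleySandwich_incr_both (valBound_of_mem_level ι Λ hΛ hxM) (valBound_of_mem_level ι Λ hΛ hxT)
    (valBound_of_mem_level ι Λ hΛ hyM) (valBound_of_mem_level ι Λ hΛ hyT) hαk1 hle hle
  rw [max_self] at key
  have hy' : ι y = ι (pM y) + ι (pT y) := by
    conv_lhs => rw [← hsum y]
    rw [map_add]
  have hdiff : ι (Ξ (x + y) - Ξ x - y) = (fun W X : Matrix m m K => (1 - W)⁻¹ * (W + X) * (1 + W * X)⁻¹ * (1 - W)) (ι (pM x) + ι (pM y)) (ι (pT x) + ι (pT y))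
      - (fun W X : Matrix m m K => (1 - W)⁻¹ * (W + X) * (1 + W * X)⁻¹ * (1 - W)) (ι (pM x)) (ι (pT x)) - ι (pM y) - ι (pT y) := by
    rw [map_sub, map_sub, hΞ _ hxy, hΞ _ hx, hy']
    simp only [map_add]
    abel
  have hmem : Ξ (x + y) - Ξ x - y ∈ Λ (j + 1 + k) := by
    rw [hΛ, hdiff, show j + 1 + k + 1 = (k + 1) + (j + 1) by ring, pow_add]
    beta_reduce
    exact key
  exact (hΛ' _ _).2 (hshift (j + 1) _ hmem)

omit [TopologicalSpace K] [IsNonarchimedeanLocalField K] [TopologicalSpace V] in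
/-- `c (Ξ Z) = c (pM Z) · c (pT Z)` on the sub-box (★ C2 `cayley_mul_cayley_eq_cayley`). [cite: PlatonovRapinchuk1994, §3.3] -/
theorem chart_product (hΛ : ∀ j X, X ∈ Λ j ↔ ValBound (α ^ (j + 1)) (ι X)) (hα1 : α < 1) (hρinj : Function.Injective ρ)
    (hc : ∀ X ∈ Λ 0, ((ρ (c X) : GL m K) : Matrix m m K) = cayley (ι X))
    (hΛ' : ∀ j Z, Z ∈ Λ' j ↔ (pM Z ∈ Λ j ∧ pT Z ∈ Λ j))
    (hΞ : ∀ Z ∈ Λ' k, ι (Ξ Z) = (1 - ι (pM Z))⁻¹ * (ι (pM Z) + ι (pT Z)) * (1 + ι (pM Z) * ι (pT Z))⁻¹ * (1 - ι (pM Z)))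
    (hΞmem : ∀ Z ∈ Λ' k, Ξ Z ∈ Λ 0) {Z : V} (hZ : Z ∈ Λ' k) : c (Ξ Z) = c (pM Z) * c (pT Z) := by
  have hanti := level_antitone ι Λ hΛ hα1.le
  obtain ⟨hM, hT⟩ := (hΛ' k Z).1 hZ
  have hM0 := hanti (Nat.zero_le k) hM
  have hT0 := hanti (Nat.zero_le k) hT
  have hMb := valBound_of_mem_level_zero ι Λ hΛ hM0
  have hTb := valBound_of_mem_level_zero ι Λ hΛ hT0
  apply hρinj
  apply Units.ext
  rw [map_mul, Units.val_mul, hc _ (hΞmem Z hZ), hc _ hM0, hc _ hT0, hΞ Z hZ,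
    cayley_mul_cayley_eq_cayley (isUnit_det_one_sub_of_valBound hMb hα1).1 (isUnit_det_one_sub_of_valBound hTb hα1).1
      (isUnit_det_one_add_mul_of_valBound hMb hTb hα1 hα1.le).1]

omit [TopologicalSpace K] [IsNonarchimedeanLocalField K] [TopologicalSpace V] [Group G] in
/-- `Ξ` maps the sub-box `Λ′ k` into the level `Λ k` (★ C2 `valBound_cayleySandwich`). [cite: Serre1992LALG, Part II Ch. IV §8] -/
theorem product_mem_level (hΛ : ∀ j X, X ∈ Λ j ↔ ValBound (α ^ (j + 1)) (ι X)) (hα1 : α < 1)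
    (hΛ' : ∀ j Z, Z ∈ Λ' j ↔ (pM Z ∈ Λ j ∧ pT Z ∈ Λ j))
    (hΞ : ∀ Z ∈ Λ' k, ι (Ξ Z) = (1 - ι (pM Z))⁻¹ * (ι (pM Z) + ι (pT Z)) * (1 + ι (pM Z) * ι (pT Z))⁻¹ * (1 - ι (pM Z)))
    {Z : V} (hZ : Z ∈ Λ' k) : Ξ Z ∈ Λ k := by
  obtain ⟨hM, hT⟩ := (hΛ' k Z).1 hZ
  have hαk1 : α ^ (k + 1) < 1 := pow_lt_one₀ zero_le hα1 (Nat.succ_ne_zero k)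
  rw [hΛ, hΞ Z hZ]
  simpa only [max_self] using valBound_cayleySandwich (valBound_of_mem_level ι Λ hΛ hM) (valBound_of_mem_level ι Λ hΛ hT) hαk1 hαk1

omit [ValuativeRel K] [TopologicalSpace K] [IsNonarchimedeanLocalField K] [TopologicalSpace V] [Group G] in
/-- `Ξ 0 = 0`. [cite: Serre1992LALG, Part II Ch. IV §8] -/
theorem product_zero (hinj : Function.Injective ι)
    (hΞ : ∀ Z ∈ Λ' k, ι (Ξ Z) = (1 - ι (pM Z))⁻¹ * (ι (pM Z) + ι (pT Z)) * (1 + ι (pM Z) * ι (pT Z))⁻¹ * (1 - ι (pM Z))) : Ξ 0 = 0 := by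
  apply hinj
  rw [hΞ 0 (zero_mem _), map_zero, map_zero, map_zero, map_zero]
  simp

/-- **`Ξ` is continuous on the sub-box** (joint continuity of the sandwich, `ι` an embedding, `pM`, `pT` continuous). [cite: Serre1992LALG, Part II Ch. IV §8] -/
theorem continuousOn_product (hι : IsClosedEmbedding ι) (hΛ : ∀ j X, X ∈ Λ j ↔ ValBound (α ^ (j + 1)) (ι X)) (hα1 : α < 1)
    (hΛ' : ∀ j Z, Z ∈ Λ' j ↔ (pM Z ∈ Λ j ∧ pT Z ∈ Λ j)) (hpMc : Continuous pM) (hpTc : Continuous pT)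
    (hΞ : ∀ Z ∈ Λ' k, ι (Ξ Z) = (1 - ι (pM Z))⁻¹ * (ι (pM Z) + ι (pT Z)) * (1 + ι (pM Z) * ι (pT Z))⁻¹ * (1 - ι (pM Z))) :
    ContinuousOn Ξ (Λ' k : Set V) := by
  rw [hι.isInducing.continuousOn_iff]
  have hαk1 : α ^ (k + 1) < 1 := pow_lt_one₀ zero_le hα1 (Nat.succ_ne_zero k)
  set S : Matrix m m K × Matrix m m K → Matrix m m K := fun p => (1 - p.1)⁻¹ * (p.1 + p.2) * (1 + p.1 * p.2)⁻¹ * (1 - p.1) with hS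
  refine ContinuousOn.congr (f := fun Z => S (ι (pM Z), ι (pT Z))) ?_ (fun Z hZ => by simpa only [Function.comp_apply, hS] using hΞ Z hZ)
  intro Z hZ
  obtain ⟨hM, hT⟩ := (hΛ' k Z).1 hZ
  have hcont : Continuous fun Z : V => (ι (pM Z), ι (pT Z)) := (hι.continuous.comp hpMc).prodMk (hι.continuous.comp hpTc)
  exact (ContinuousAt.comp (g := S) (f := fun Z : V => (ι (pM Z), ι (pT Z)))
    (continuousAt_sandwich_of_valBound (valBound_of_mem_level ι Λ hΛ hM) (valBound_of_mem_level ι Λ hΛ hT) hαk1 hαk1.le) hcont.continuousAt).continuousWithinAt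

/-- **The tube map `Θ` of ★ (C8b-core) is continuous on the sub-box** (same mechanism, two sandwiches; `T`, `T⁻¹` integral). [cite: HarishChandra1970, Lemma 22] -/
theorem continuousOn_twisted (hι : IsClosedEmbedding ι) (hΛ : ∀ j X, X ∈ Λ j ↔ ValBound (α ^ (j + 1)) (ι X)) (hα1 : α < 1)
    (hΛ' : ∀ j Z, Z ∈ Λ' j ↔ (pM Z ∈ Λ j ∧ pT Z ∈ Λ j)) (hpMc : Continuous pM) (hpTc : Continuous pT)
    {T Tinv : Matrix m m K} (hT1 : ValBound 1 T) (hTinv1 : ValBound 1 Tinv) (Θ : V → V)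
    (hΘ : ∀ Z ∈ Λ' k, ι (Θ Z) =
      (fun W X : Matrix m m K => (1 - W)⁻¹ * (W + X) * (1 + W * X)⁻¹ * (1 - W)) (Tinv * ι (pM Z) * T)
        ((fun W X : Matrix m m K => (1 - W)⁻¹ * (W + X) * (1 + W * X)⁻¹ * (1 - W)) (ι (pT Z)) (-ι (pM Z)))) :
    ContinuousOn Θ (Λ' k : Set V) := by
  rw [hι.isInducing.continuousOn_iff]
  have hαk1 : α ^ (k + 1) < 1 := pow_lt_one₀ zero_le hα1 (Nat.succ_ne_zero k)
  set S : Matrix m m K × Matrix m m K → Matrix m m K := fun p => (1 - p.1)⁻¹ * (p.1 + p.2) * (1 + p.1 * p.2)⁻¹ * (1 - p.1) with hS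
  refine ContinuousOn.congr (f := fun Z => S (Tinv * ι (pM Z) * T, S (ι (pT Z), -ι (pM Z)))) ?_ (fun Z hZ => by simpa only [Function.comp_apply, hS] using hΘ Z hZ)
  intro Z hZ
  obtain ⟨hM, hT⟩ := (hΛ' k Z).1 hZ
  have hMb := valBound_of_mem_level ι Λ hΛ hM
  have hTb := valBound_of_mem_level ι Λ hΛ hT
  have hinner : ContinuousAt (fun Z : V => S (ι (pT Z), -ι (pM Z))) Z :=
    ContinuousAt.comp (g := S) (f := fun Z : V => (ι (pT Z), -ι (pM Z))) (continuousAt_sandwich_of_valBound hTb hMb.neg hαk1 hαk1.le)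
      ((hι.continuous.comp hpTc).prodMk (hι.continuous.comp hpMc).neg).continuousAt
  have hconj : Continuous fun Z : V => Tinv * ι (pM Z) * T := (continuous_const.mul (hι.continuous.comp hpMc)).mul continuous_const
  have hSb : ValBound (α ^ (k + 1)) (S (ι (pT Z), -ι (pM Z))) := by simpa only [hS, max_self] using valBound_cayleySandwich hTb hMb.neg hαk1 hαk1
  exact (ContinuousAt.comp (g := S) (f := fun Z : V => (Tinv * ι (pM Z) * T, S (ι (pT Z), -ι (pM Z))))
    (continuousAt_sandwich_of_valBound (valBound_conj hT1 hTinv1 hMb) hSb hαk1 hαk1.le) (hconj.continuousAt.prodMk hinner)).continuousWithinAt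

end Product

end Summit.HodgeConjecture.HodgeConjecture.Cruxes.H413.F0P3cStCharTSJacCartanProduct
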